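import Literature.Barriers.CriticalPhenomena.GridSAWCountingAnyLengthAssembly
import Literature.Barriers.CriticalPhenomena.GridSAWCountingGridHamPathHardnessProofs
import HarnessLib

/-!
# Discharges of named facts of `GridSAWCountingSharpPComplete.lean`

`Literature/Barriers/CriticalPhenomena/GridSAWCountingSharpPCompleteHolds.lean` — proofs-only
sibling of `GridSAWCountingSharpPComplete.lean` (no definitions, no named facts). Each theorem
below closes a named fact `X : Prop` of that file as `X_holds : X` by composing an ACCEPTED
reduction theorem of the tree with the ACCEPTED unconditional `_holds` discharges of all of
its hypotheses; nothing is re-proved and no statement is changed. Recorded by the librarian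
sweep g25 (2026-08-16, pass 5c: facts dischargeable in one line from the tree's own lemmas),
so that the facts census, `#h21_route_deps` and the cone guardrail see these facts as
theorems.

Discharged here:

* `LOT2003_thm7_anyLength_holds` := `LOT2003_thm7_anyLength_of_gadgets`
  `LOT2003_lemma4_gadgets_holds` (`GridSAWCountingAnyLengthAssembly.lean`).

## References

* [LiskiewiczOgiharaToda2003] — see `lean/references.bib` and the docstring of the fact in `GridSAWCountingSharpPComplete.lean`.
-/

namespace Literature.Barriers.CriticalPhenomena.GridSAW

/-- **Discharge of the named fact `LOT2003_thm7_anyLength`**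
(`GridSAWCountingSharpPComplete.lean`): Theorem 7, version (4) of Liśkiewicz–Ogihara–Toda
2003: counting "the SAWs from the origin to a specific point having any length" in subgraphs
of two-dimensional grids is complete for `#P` under `≤ᵖ_{r-shift}`-reductions (the
construction `E₃` with … — obtained as `LOT2003_thm7_anyLength_of_gadgets` applied to the
tree's unconditional discharge `LOT2003_lemma4_gadgets_holds` of its hypothesis (reduction in
`GridSAWCountingAnyLengthAssembly.lean`).
[cite: LiskiewiczOgiharaToda2003, Theorem 7 (version (4))] -/
theorem LOT2003_thm7_anyLength_holds :
    LOT2003_thm7_anyLength :=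
  LOT2003_thm7_anyLength_of_gadgets LOT2003_lemma4_gadgets_holds

end Literature.Barriers.CriticalPhenomena.GridSAW
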